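import Literature.Computability.MetaComplexity.BoundedArithTheories
import Literature.Computability.MetaComplexity.BoundedArithModels
import HarnessLib

/-!
# The standard model `ℕ` of `BASIC`, `S₂ⁱ`, `T₂ⁱ`: discharge of the named facts

Sibling proof file of `BoundedArithTheories.lean` (D-0014: named facts `def X : Prop` are
discharged as `theorem X_holds : X`).  It discharges the three *standard model* facts stated
there:

* `Literature.Computability.MetaComplexity.model_nat_BASIC_holds` — `ℕ ⊨ BASIC`: each of Buss's
  32 open axioms is true under the standard interpretation `0, S, ⌊·/2⌋, |x| = Nat.size x, +, ·,
  x # y = 2 ^ (|x|·|y|), ≤` (Buss 1986, §1.1, §2.2; Krajíček 1995, §5.2, p. 65 and Def. 5.2.1);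
* `Literature.Computability.MetaComplexity.model_nat_T2_holds`,
  `Literature.Computability.MetaComplexity.model_nat_S2_holds` — `ℕ ⊨ T₂ⁱ` and `ℕ ⊨ S₂ⁱ` for
  every `i`: on top of `BASIC`, every `IND` axiom holds in `ℕ` by ordinary induction
  (`realize_nat_indAxiom`) and every `PIND` axiom by induction on binary notation
  (`realize_nat_pindAxiom`) — for *all* formulas, not only `Σᵇᵢ` ones (Buss 1986, §2.3–2.4;
  Krajíček 1995, Def. 5.2.2–5.2.3), via the semantic form of the axioms
  (`realize_indAxiom_iff`, `realize_pindAxiom_iff` of `BoundedArithModels.lean`).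

The printed sources take the truth of these axioms in `ℕ` for granted (it is the intended
interpretation); the proofs below are the routine verification.

## References

* S. R. Buss, *Bounded Arithmetic*, Bibliopolis 1986, §1.1, §2.2–2.4.
* J. Krajíček, *Bounded Arithmetic, Propositional Logic and Complexity Theory*, CUP 1995,
  §5.2, Def. 5.2.1–5.2.3.
-/

namespace Literature.Computability.MetaComplexity

open FirstOrder FirstOrder.Language

/-! ## `ℕ ⊨ BASIC` -/

/-- `|2a| = |a| + 1` for `a ≠ 0` (Mathlib `Nat.size_bit`; Buss 1986, §2.2, axiom 10;
Krajíček 1995, Def. 5.2.1 (10)). [cite: Buss1986, §2.2 axiom 10] -/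
private theorem size_two_mul_of_ne_zero {a : ℕ} (h : a ≠ 0) : (2 * a).size = a.size + 1 := by
  have := Nat.size_bit (b := false) (n := a) (by simpa using h)
  simpa [Nat.bit_val] using this

/-- `|2a + 1| = |a| + 1` (Mathlib `Nat.size_bit`; Buss 1986, §2.2, axiom 10; Krajíček 1995,
Def. 5.2.1 (10)). [cite: Buss1986, §2.2 axiom 10] -/
private theorem size_two_mul_succ (a : ℕ) : (2 * a + 1).size = a.size + 1 := by
  have := Nat.size_bit (b := true) (n := a) (by simp)
  simpa [Nat.bit_val] using this

/-- `|a| = |⌊a/2⌋| + 1` for `a ≠ 0` (Buss 1986, §2.2, axiom 31; Krajíček 1995, Def. 5.2.1 (31)),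
from the two halves of axiom 10 by cases on the parity of `a`. [cite: Buss1986, §2.2 axiom 31] -/
private theorem size_eq_size_div_two_succ {a : ℕ} (h : a ≠ 0) :
    a.size = (a / 2).size + 1 := by
  rcases Nat.even_or_odd' a with ⟨k, rfl | rfl⟩
  · have hk : k ≠ 0 := by rintro rfl; exact h rfl
    rw [size_two_mul_of_ne_zero hk, Nat.mul_div_cancel_left k two_pos]
  · rw [size_two_mul_succ]
    congr 2
    omega

/-- **Discharge of `model_nat_BASIC`.** The standard model `ℕ` (with `|x| = Nat.size x`,
`x # y = 2 ^ (|x|·|y|)`; Buss 1986, §1.1; Krajíček 1995, §5.2, p. 65) satisfies all 32 axioms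
of `BASIC` (Buss 1986, §2.2; Krajíček 1995, Def. 5.2.1): after unfolding the semantics of each
universally closed open axiom, axioms 1–8, 19–25 and 32 are linear arithmetic (`omega`), 26–29
are semiring identities, 30 is cancellation of a positive factor, and the `|·|` / `#` axioms
9–18 and 31 reduce to Mathlib's `Nat.size_zero`, `Nat.size_bit`, `Nat.size_pow`,
`Nat.size_le_size` and `pow_add`. [cite: Buss1986, §2.2] -/
theorem model_nat_BASIC_holds : model_nat_BASIC := by
  refine ⟨fun φ hφ => ?_⟩
  simp only [BASIC, Set.mem_setOf_eq, basicAxioms, List.mem_cons, List.not_mem_nil,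
    or_false] at hφ
  rcases hφ with rfl | rfl | rfl | rfl | rfl | rfl | rfl | rfl | rfl | rfl | rfl | rfl | rfl |
    rfl | rfl | rfl | rfl | rfl | rfl | rfl | rfl | rfl | rfl | rfl | rfl | rfl | rfl | rfl |
    rfl | rfl | rfl | rfl <;>
  simp [Sentence.Realize, Formula.Realize, BoundedFormula.alls, Fin.snoc] <;> intros <;>
  first
    | omega
    | exact Nat.mul_comm _ _
    | exact Nat.size_le_size ‹_›
    | exact size_eq_size_div_two_succ ‹_›
    | exact ⟨fun h => Nat.le_of_mul_le_mul_left h (by omega), fun h => Nat.mul_le_mul_left _ h⟩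
    | ring1
    | simp_all [size_two_mul_of_ne_zero, size_two_mul_succ, Nat.size_pow, pow_succ', add_mul,
        pow_add]

/-! ## `ℕ ⊨ T₂ⁱ`, `ℕ ⊨ S₂ⁱ` -/

/-- Every `IND` axiom is true in the standard model `ℕ`: ordinary induction (Buss 1986, §2.3;
Krajíček 1995, Def. 5.2.2). [cite: Buss1986, §2.3] -/
theorem realize_nat_indAxiom {k : ℕ} (φ : Language.boundedArith.Formula (Fin (k + 1))) :
    ℕ ⊨ indAxiom φ := by
  rw [realize_indAxiom_iff]
  intro p h0 hs a
  induction a with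
  | zero => exact h0
  | succ a ih => exact hs a ih

/-- Every `PIND` axiom is true in the standard model `ℕ`: induction on binary notation
(Mathlib `Nat.binaryRec'`; Buss 1986, §2.3; Krajíček 1995, Def. 5.2.3). [cite: Buss1986, §2.3] -/
theorem realize_nat_pindAxiom {k : ℕ} (φ : Language.boundedArith.Formula (Fin (k + 1))) :
    ℕ ⊨ pindAxiom φ := by
  rw [realize_pindAxiom_iff]
  intro p h0 hs a
  induction a using Nat.binaryRec' with
  | zero => exact h0
  | bit b a _ ih =>
    refine hs _ ?_
    simpa [Nat.bit_div_two] using ih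

/-- `ℕ` satisfies the whole scheme `Φ-IND`, for any family `Φ` of induction formulas
(Buss 1986, §2.3). [cite: Buss1986, §2.3] -/
theorem model_nat_INDScheme (Φ : ∀ k, Set (Language.boundedArith.Formula (Fin (k + 1)))) :
    ℕ ⊨ INDScheme Φ := by
  refine ⟨fun φ hφ => ?_⟩
  simp only [INDScheme, Set.mem_iUnion, Set.mem_image] at hφ
  obtain ⟨k, ψ, -, rfl⟩ := hφ
  exact realize_nat_indAxiom ψ

/-- `ℕ` satisfies the whole scheme `Φ-PIND`, for any family `Φ` of induction formulas
(Buss 1986, §2.3). [cite: Buss1986, §2.3] -/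
theorem model_nat_PINDScheme (Φ : ∀ k, Set (Language.boundedArith.Formula (Fin (k + 1)))) :
    ℕ ⊨ PINDScheme Φ := by
  refine ⟨fun φ hφ => ?_⟩
  simp only [PINDScheme, Set.mem_iUnion, Set.mem_image] at hφ
  obtain ⟨k, ψ, -, rfl⟩ := hφ
  exact realize_nat_pindAxiom ψ

/-- **Discharge of `model_nat_T2`.** The standard model `ℕ` is a model of every `T₂ⁱ`:
`BASIC` holds (`model_nat_BASIC_holds`) and every `IND` axiom holds by induction
(Buss 1986, §2.4; Krajíček 1995, Def. 5.2.2). [cite: Buss1986, §2.4] -/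
theorem model_nat_T2_holds : model_nat_T2 :=
  fun i => model_nat_BASIC_holds.union (model_nat_INDScheme (sigmabFormulas i))

/-- **Discharge of `model_nat_S2`.** The standard model `ℕ` is a model of every `S₂ⁱ`:
`BASIC` holds (`model_nat_BASIC_holds`) and every `PIND` axiom holds by induction on binary
notation (Buss 1986, §2.4; Krajíček 1995, Def. 5.2.3). [cite: Buss1986, §2.4] -/
theorem model_nat_S2_holds : model_nat_S2 :=
  fun i => model_nat_BASIC_holds.union (model_nat_PINDScheme (sigmabFormulas i))

/-- `ℕ` is a model of `S₂ = ⋃ᵢ S₂ⁱ` (Buss 1986, §2.4). [cite: Buss1986, §2.4] -/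
theorem model_nat_S2Union : ℕ ⊨ S2Union := by
  refine ⟨fun φ hφ => ?_⟩
  obtain ⟨i, hi⟩ := Set.mem_iUnion.1 hφ
  exact (model_nat_S2_holds i).realize_of_mem φ hi

end Literature.Computability.MetaComplexity
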